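import Literature.Computability.Complexity.ScaledPCPPositions
import Literature.Computability.Complexity.ScaledPCPDecideFP
import Literature.Computability.Complexity.HonestMessages
import Literature.Computability.Complexity.FETables
import HarnessLib

/-!
# The honest proof table of the scaled PCP verifier is an `FE` object

Literature / complexity toolkit, the PROVER side of `ScaledPCP.verifier' M T`
(`ScaledPCPVerifier.lean`, completeness with the table `honestTable M T x : ℕ → Bool`): a string map
`P ∈ FE` whose table agrees with `honestTable M T x` on every position the verifier can read, so
that `P x` is accepted with probability `1` whenever `honestTable` is. The bits are recomputed over
residues — the oracle region through `YhN` (`HonestTableLDE.lean`, `cast_YhN`), the message region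
through `PCtx.msgCoeffsN` (`HonestMessages.lean`, `cast_msgCoeffsN`) after decoding the position as
`encodeProof` does (`sIdx_decode`) — in polynomial time ON THE PAD `⟨1^{2^{a|x|}} 0 1^{a|x|}, x⟩`
(`FETables.lean`), the budget `2^{a_N |x| + a_N}` covering the step count, the cube `hᴷ` of the
sumcheck and every position read (`ScaledPCPPositions.lean`):

* `budgetN`, `pctx` (the prover's context), `yBit`, `sBit`, **`tableBit`**; the agreements
  `tableBit_eq_of_lt_baseS` (oracle region) and `tableBit_posS` (message positions with prefixes of
  length `< K`), hence **`tableBit_eq_of_mem_queries`**;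
* the programmes on the pad (`padX`, …, `padBudgetC`, `yBitC`, `sBitC`, `tableBitC`) and
  **`exists_table_FE : ∃ P ∈ FE, ∀ x ρ, ∀ q ∈ queriesOf M T x ρ, (P x).getD q false = honestTable M T x q`**;
* `acceptProb_table` : the tabulated proof is accepted exactly as often as `honestTable`.

All proved; no named fact.

## References

* H. Buhrman, L. Fortnow, A. Pavan, *Some results on derandomization*, Theory Comput. Syst. 38
  (2005), Thm. 3.3 ("a probabilistically checkable proof … computable in time `2^{O(n)}`")
  [BuhrmanFortnowPavan2004].
* L. Babai, L. Fortnow, L. Levin, M. Szegedy, *Checking computations in polylogarithmic time*,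
  STOC 1991, §4–§5 (the encoded computation and the honest prover) [BFLS1991].
* S. Arora, B. Barak, *Computational Complexity: A Modern Approach*, CUP 2009, §2.6.2 (padding),
  Def. 11.4 (nonadaptivity: only queried positions matter) [AroraBarakCC2009].
-/

noncomputable section

open Finset Polynomial

namespace Literature.Computability.Complexity

namespace ScaledPCP

open CodeFP Turing Tableau TableauCSP AlgebraicPCP LowDegreeTest LowDegreeExtension SumcheckF ModArith TabEval DigitPoly
  _root_.Computability

attribute [local instance] Turing.FinTM2.kFin Turing.FinTM2.ΛFin Turing.FinTM2.σFin
  Turing.FinTM2.Γk₀Fin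

/-! ### The recomputed table -/

section Table

variable (M : TM2ComputableAux Bool Bool) (T : ℕ → ℕ) (cT : ℕ) (x : List Bool)

local notation "n" => x.length
local notation "p" => pN M T x.length
local notation "𝔽" => FF M T x.length
local notation "KK" => KN M T x.length
local notation "mm" => mN M T x.length
local notation "DD" => DN M T x.length
local notation "CC" => CN M T x.length x
local notation "HH" => HN M T x.length
local notation "prm" => prmN M T x.length
local notation "d" => dM M

/-- The budget `2^{a_N n + a_N}`. [folklore] -/
def budgetN (n' : ℕ) : ℕ := 2 ^ (aN M cT * n' + aN M cT)

/-- **The prover's context** for `x`: parameters, `K`, `D`, step counts, the budget, the descriptors. [folklore] -/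
def pctx : PCtx := actx p M (LN M T n) x [] 0 (T n) DD (budgetN M cT n)

/-- **A bit of the oracle region**: bit `i mod b₀` of `Ŷ` at the point of index `⌊i / b₀⌋`. [cite: BFLS1991, §4] -/
def yBit (i : ℕ) : Bool :=
  decide (YhN M p (hN M n) (ktN M T n) (kJN M T n) x [] (T n + 1) (S1N M T n + 1) (digitsLE p mm (i / b0 M T n)) /
    2 ^ (i % b0 M T n) % 2 = 1)

/-- **A bit of the message region**: decode `(ρ, λ, prefix, j)` from the position as `encodeProof`
does, recompute coefficient `j` of the honest message, take bit `i mod b₀`. [cite: BFLS1991, §5] -/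
def sBit (i : ℕ) : Bool :=
  let k' := i - baseS M T n
  let q := k' / b0 M T n
  let s := q / (DD + 1)
  let s₁ := s / p ^ KK
  let s₂ := s₁ / (KK + 1)
  decide (((pctx M T cT x).msgCoeffsN M d (digitsLE p KK (s₂ / p)) (s₂ % p) ((digitsLE p KK (s % p ^ KK)).take (s₁ % (KK + 1)))).getD
    (q % (DD + 1)) 0 / 2 ^ (k' % b0 M T n) % 2 = 1)

/-- **The recomputed table.** [cite: BuhrmanFortnowPavan2004, Thm. 3.3] -/
def tableBit (i : ℕ) : Bool := if i < baseS M T n then yBit M T x i else sBit M T cT x i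

/-! ### Agreement with `honestTable` -/

/-- The honest proof of the analysis. [folklore] -/
abbrev hP : Proof 𝔽 KK mm (CC).N :=
  honestProof HH prm CC (Y0 M (LN M T n) x 0 (T n) (Tableau.intended (M := M) x 0 (T n) [])) (hd_le M T x) (one_le_dN M T (x := x)) (hD_le M T x)

/-- `honestTable` is the table of `hP`. [folklore] -/
theorem honestTable_eq : honestTable M T x = encodeProof M T (hP M T x) := rfl

/-- The digit list of an index is the residue list of its vector. [folklore] -/
theorem digitsLE_eq_ofFn_vecOfIdx (k N : ℕ) : digitsLE p k N = List.ofFn fun s : Fin k => (vecOfIdx M T n k N s).val := by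
  apply List.ext_getElem
  · simp [digitsLE]
  · intro t h1 h2
    rw [List.length_ofFn] at h2
    rw [List.getElem_ofFn, ← List.getD_eq_getElem _ 0 h1, getD_digitsLE h2]
    unfold vecOfIdx
    rw [ZMod.val_cast_of_lt (Nat.mod_lt _ (pN_prime M T n).pos)]

/-- The digit list of `vecIdx w` is the residue list of `w`. [folklore] -/
theorem digitsLE_vecIdx {k : ℕ} (w : Fin k → 𝔽) : digitsLE p k (vecIdx M T n w) = List.ofFn fun s : Fin k => (w s).val := by
  rw [digitsLE_eq_ofFn_vecOfIdx, vecOfIdx_vecIdx]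

/-- A bit of a residue through `testBit`. [folklore] -/
theorem getD_bitsF (a : 𝔽) {r : ℕ} (hr : r < b0 M T n) : (bitsF M T n a).getD r false = decide (a.val / 2 ^ r % 2 = 1) := by
  unfold bitsF
  rw [getD_natBits _ _ _ hr, Nat.testBit_eq_decide_div_mod_eq]

/-- **The oracle region agrees.** [cite: BFLS1991, §4] -/
theorem tableBit_eq_of_lt_baseS {i : ℕ} (hi : i < baseS M T n) : tableBit M T cT x i = honestTable M T x i := by
  unfold tableBit
  rw [if_pos hi, honestTable_eq, encodeProof, if_pos hi, getD_bitsF M T x _ (Nat.mod_lt _ (b0_pos M T n))]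
  unfold yBit
  -- `Ŷ` at the point of index `i / b₀`
  have hh : (LN M T n).h ≤ p := (hN_lt_pN' M T n).le
  have hT : T n < (LN M T n).h ^ (LN M T n).kt := by show T n < hN M n ^ ktN M T n; unfold ktN; exact Nat.lt_pow_succ_log_self (two_le_hN M n) _
  have hS : S1 M n 0 (T n) < (LN M T n).h ^ (LN M T n).kJ := by
    show S1N M T n < hN M n ^ kJN M T n; unfold kJN; exact Nat.lt_pow_succ_log_self (two_le_hN M n) _
  have e := cast_YhN (M := M) (L := LN M T n) hh (card_val_le_hN M x) (x := x) (u := []) (P := 0) (T := T n) hT hS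
    (vecOfIdx M T n mm (i / b0 M T n))
  have hlt := YhN_lt M (pN_prime M T n).pos (hN M n) (ktN M T n) (kJN M T n) x [] (T n + 1) (S1N M T n + 1)
    (List.ofFn fun s : Fin mm => (vecOfIdx M T n mm (i / b0 M T n) s).val)
  have e' : YhN M p (hN M n) (ktN M T n) (kJN M T n) x [] (T n + 1) (S1N M T n + 1)
      (List.ofFn fun s : Fin mm => (vecOfIdx M T n mm (i / b0 M T n) s).val) = ((hP M T x).Y (vecOfIdx M T n mm (i / b0 M T n))).val := by
    have := congrArg ZMod.val e
    rw [ZMod.val_natCast] at this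
    rw [← Nat.mod_eq_of_lt hlt]
    exact this
  rw [digitsLE_eq_ofFn_vecOfIdx, e']

/-- Entries of the coefficient list are reduced. [folklore] -/
theorem msgCoeffsN_getD_lt (c : PCtx) (hq : 0 < c.π.q) (ρl : List ℕ) (seed : ℕ) (pref : List ℕ) (j : ℕ) :
    (c.msgCoeffsN M d ρl seed pref).getD j 0 < c.π.q := by
  unfold PCtx.msgCoeffsN
  rw [List.getD_eq_getElem?_getD, List.getElem?_map]
  cases h : (List.range (c.D + 1))[j]? with
  | none => simpa using hq
  | some a => simp only [Option.map_some, Option.getD_some]; rw [sumM_eq]; exact Nat.mod_lt _ hq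

/-- **The message positions agree** (prefixes of length `< K`, coefficients `j ≤ D`, bits `r < b₀`).
[cite: BFLS1991, §5] -/
theorem tableBit_posS (hTb : ∀ n', T n' ≤ 2 ^ (cT * n' + cT)) (ρ : Fin KK → 𝔽) (seed : 𝔽) {pref : List 𝔽} (hpref : pref.length < KK)
    {j r : ℕ} (hj : j ≤ DD) (hr : r < b0 M T n) :
    tableBit M T cT x (posS M T n ρ seed pref j r) = honestTable M T x (posS M T n ρ seed pref j r) := by
  have hb := b0_pos M T n
  obtain ⟨e1, e2, e3, e4⟩ := sIdx_decode M T ρ seed hpref.le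
  have hpos : posS M T n ρ seed pref j r = baseS M T n + (r + (j + sIdx M T n ρ seed pref * (DD + 1)) * b0 M T n) := by
    unfold posS; ring
  have hq : (r + (j + sIdx M T n ρ seed pref * (DD + 1)) * b0 M T n) / b0 M T n = j + sIdx M T n ρ seed pref * (DD + 1) := by
    rw [Nat.add_mul_div_right _ _ hb, Nat.div_eq_of_lt hr, zero_add]
  have hs : (j + sIdx M T n ρ seed pref * (DD + 1)) / (DD + 1) = sIdx M T n ρ seed pref := by
    rw [Nat.add_mul_div_right _ _ (Nat.succ_pos _), Nat.div_eq_of_lt (Nat.lt_succ_of_le hj), zero_add]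
  have hm1 : (r + (j + sIdx M T n ρ seed pref * (DD + 1)) * b0 M T n) % b0 M T n = r := by
    rw [Nat.add_mul_mod_self_right, Nat.mod_eq_of_lt hr]
  have hm2 : (j + sIdx M T n ρ seed pref * (DD + 1)) % (DD + 1) = j := by
    rw [Nat.add_mul_mod_self_right, Nat.mod_eq_of_lt (Nat.lt_succ_of_le hj)]
  have hge : ¬ posS M T n ρ seed pref j r < baseS M T n := by rw [hpos]; omega
  -- the analysis side
  rw [honestTable_eq, hpos, encodeProof_base_add, hq, hs, hm1, hm2, e1, e2, e3, e4, vecOfIdx_vecIdx, vecOfIdx_vecIdx, ZMod.natCast_zmod_val,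
    take_ofFn_prefVec M T hpref.le, getD_bitsF M T x _ hr]
  -- the recomputed side
  unfold tableBit
  rw [← hpos, if_neg hge, hpos]
  unfold sBit
  dsimp only
  rw [Nat.add_sub_cancel_left, hq, hs, hm1, hm2, e1, e2, e3, e4, digitsLE_vecIdx, digitsLE_vecIdx]
  -- the coefficient through `cast_msgCoeffsN`
  have hh : (LN M T n).h ≤ p := (hN_lt_pN' M T n).le
  have hD : DD + 1 ≤ p := (small_le_pN M T (x := x)).2.1
  have hNB : (LN M T n).h ^ KIdx (LN M T n) d ≤ budgetN M cT n := by exact hN_pow_KN_le M T cT hTb n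
  have hT : T n < (LN M T n).h ^ (LN M T n).kt := by show T n < hN M n ^ ktN M T n; unfold ktN; exact Nat.lt_pow_succ_log_self (two_le_hN M n) _
  have hS : S1 M n 0 (T n) < (LN M T n).h ^ (LN M T n).kJ := by
    show S1N M T n < hN M n ^ kJN M T n; unfold kJN; exact Nat.lt_pow_succ_log_self (two_le_hN M n) _
  have hprefN_eq : (List.ofFn fun s : Fin KK => (prefVec M T n pref s).val).take pref.length = pref.map ZMod.val := by
    apply List.ext_getElem
    · rw [List.length_take, List.length_ofFn, List.length_map, min_eq_left hpref.le]
    · intro t h1 h2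
      rw [List.length_map] at h2
      rw [List.getElem_take, List.getElem_ofFn, List.getElem_map]
      unfold prefVec
      rw [List.getD_eq_getElem _ _ h2]
  rw [hprefN_eq]
  have hlen : (pref.map ZMod.val).length < KIdx (LN M T n) d := by rw [List.length_map]; exact hpref
  have hlt : ∀ a ∈ pref.map ZMod.val, a < p := by
    intro a ha; obtain ⟨b, -, rfl⟩ := List.mem_map.1 ha; exact ZMod.val_lt b
  have e := cast_msgCoeffsN (M := M) (L := LN M T n) hh (card_val_le_hN M x) hT hS (x := x) (u := []) (P := 0) (T := T n) (D := DD)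
    (NB := budgetN M cT n) hD hNB ρ seed ((axisPoly_Φ (C := CC) (H := HH) (linePoly_lde HH prm _ (hd_le M T x)) (one_le_dN M T (x := x)) ρ
      fun φ => seed ^ (φ : ℕ)).mono (hD_le M T x)) (pref.map ZMod.val) hlen hlt j
  have hcast : (pref.map ZMod.val).map (Nat.cast : ℕ → 𝔽) = pref := by
    rw [List.map_map]
    conv_rhs => rw [← List.map_id pref]
    exact List.map_congr_left fun a _ => ZMod.natCast_zmod_val a
  rw [hcast] at e
  have e' : ((pctx M T cT x).msgCoeffsN M d (List.ofFn fun s : Fin KK => (ρ s).val) seed.val (pref.map ZMod.val)).getD j 0 =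
      (((hP M T x).S ρ seed pref).coeff j).val := by
    have := congrArg ZMod.val e
    rw [ZMod.val_natCast] at this
    rw [← Nat.mod_eq_of_lt (msgCoeffsN_getD_lt M (pctx M T cT x) (by exact (pN_prime M T n).pos)
      (List.ofFn fun s : Fin KK => (ρ s).val) seed.val (pref.map ZMod.val) j)]
    exact this
  rw [e']

/-- **The recomputed table agrees with `honestTable` on every position the verifier can read.**
[cite: AroraBarakCC2009, Def. 11.4] -/
theorem tableBit_eq_of_mem_queries (hTb : ∀ n', T n' ≤ 2 ^ (cT * n' + cT)) (ρc : List Bool) :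
    ∀ q ∈ queriesOf M T x ρc, tableBit M T cT x q = honestTable M T x q := by
  intro q hq
  unfold queriesOf at hq
  split_ifs at hq with hg
  · rcases List.mem_append.1 hq with hq | hq
    · unfold ptQueries at hq
      obtain ⟨w, -, hw⟩ := List.mem_flatMap.1 hq
      obtain ⟨i, hi, rfl⟩ := List.mem_map.1 hw
      exact tableBit_eq_of_lt_baseS M T cT x (posY_lt M T n w (List.mem_range.1 hi))
    · unfold msgQueries msgArgs at hq
      obtain ⟨pref, hpref, hq⟩ := List.mem_flatMap.1 hq
      obtain ⟨i', hi', rfl⟩ := List.mem_map.1 hpref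
      obtain ⟨j, hj, hq⟩ := List.mem_flatMap.1 hq
      obtain ⟨i, hi, rfl⟩ := List.mem_map.1 hq
      have hlen : ((List.ofFn (tapeOf M T x ρc).r).take i').length < KK := by
        rw [List.length_take, List.length_ofFn, min_eq_left (List.mem_range.1 hi').le]; exact List.mem_range.1 hi'
      exact tableBit_posS M T cT x hTb _ _ hlen (Nat.le_of_lt_succ (List.mem_range.1 hj)) (List.mem_range.1 hi)
  · simp at hq

/-- **A tabulation of `tableBit` below the budget is accepted exactly as `honestTable` is.**
[cite: AroraBarakCC2009, Def. 11.4 (nonadaptivity)] -/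
theorem acceptProb_table (hTb : ∀ n', T n' ≤ 2 ^ (cT * n' + cT)) {P : List Bool → List Bool}
    (hP : ∀ y, P y = (List.range (budgetN M cT y.length)).map (tableBit M T cT y)) :
    (verifier' M T).acceptProb x (fun i => (P x).getD i false) = (verifier' M T).acceptProb x (honestTable M T x) := by
  have hacc : ∀ ρc, (verifier' M T).accepts x (fun i => (P x).getD i false) ρc = (verifier' M T).accepts x (honestTable M T x) ρc := by
    intro ρc
    refine PCPVerifier.accepts_congr (verifier' M T) x ρc fun q hq => ?_
    have hq' : q ∈ queriesOf M T x ρc := hq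
    rw [getD_table hP x q, tableBit_eq_of_mem_queries M T cT x hTb ρc q hq',
      decide_eq_true ((queries_lt M T ρc q hq').trans_le (by exact pow_pN_le M T cT hTb n)), Bool.true_and]
  unfold PCPVerifier.acceptProb
  rw [show {ρ | (verifier' M T).accepts x (fun i => (P x).getD i false) ρ = true} = {ρ | (verifier' M T).accepts x (honestTable M T x) ρ = true}
    from Set.ext fun ρc => by rw [Set.mem_setOf_eq, Set.mem_setOf_eq, hacc]]

end Table

/-! ### The table on the pad, in polynomial time -/

section FP

variable (M : TM2ComputableAux Bool Bool) (T : ℕ → ℕ) (hTc : CodeFP unE natE T) (cT : ℕ) (hTb : ∀ n, T n ≤ 2 ^ (cT * n + cT))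

local notation "d" => dM M
local notation "inP" => pairE (lpadE (aN M cT)) natE

/-- The payload `x` of the pad, paired with an empty string (to reuse the lifts off input pairs). [folklore] -/
theorem padX : CodeFP inP (pairE strE strE) (fun t => (t.1, ([] : List Bool))) :=
  ((lpadArg (aN M cT)).comp (CodeFP.fst _ _)).pair (CodeFP.const _ [])

/-- **The budget `2^{a_N n + a_N}` in unary**, read off the pad. [folklore] -/
theorem padBudgetC : CodeFP inP unE (fun t => budgetN M cT t.1.length) :=
  ((unMulConst (2 ^ aN M cT)).comp ((lpadBudget (aN M cT)).comp (CodeFP.fst _ _))).congr fun t => by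
    unfold budgetN; rw [pow_add, Nat.mul_comm]

include hTc hTb in
/-- **The step count `T n + 1` in unary** (exact, the budget dominating it). [folklore] -/
theorem TBC : CodeFP inP unE (fun t => T t.1.length + 1) :=
  (unSucc.comp (unOfNatMin.comp ((padBudgetC M cT).pair (ofLen hTc (padX M cT))))).congr fun t => by
    dsimp only
    rw [min_eq_left (by exact T_le_budget M T cT hTb t.1.length)]

include hTc hTb in
/-- **The last block index `S₁ + 1` in unary.** [folklore] -/
theorem SBC : CodeFP inP unE (fun t => S1N M T t.1.length + 1) :=
  (unSucc.comp (unOfNatMin.comp ((padBudgetC M cT).pair (ofLen (S1NC M T hTc) (padX M cT))))).congr fun t => by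
    dsimp only
    rw [min_eq_left (by exact S1N_le_budget M T cT hTb t.1.length)]

include hTc hTb in
/-- Bit `i mod b₀` of a computed numeral. [folklore] -/
theorem bitOfC {V : (List Bool × ℕ) → ℕ} (hV : CodeFP inP natE V) {R : (List Bool × ℕ) → ℕ} (hR : CodeFP inP natE R)
    (hRlt : ∀ t, R t < b0 M T t.1.length) : CodeFP inP bitE (fun t => decide (V t / 2 ^ R t % 2 = 1)) := by
  have hru : CodeFP inP unE R :=
    (unOfNatMin.comp ((ofLen (b0U M T hTc cT hTb) (padX M cT)).pair hR)).congr fun t => min_eq_left (hRlt t).le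
  exact natEq.comp ((natMod.comp ((natDiv.comp (hV.pair (natPow.comp ((CodeFP.const _ 2).pair hru)))).pair (CodeFP.const _ 2))).pair
    (CodeFP.const _ 1))

include hTc hTb in
/-- **The oracle-region bit** on the pad. [cite: BFLS1991, §4] -/
theorem yBitC : CodeFP inP bitE (fun t => yBit M T t.1 t.2) := by
  have hX := padX M cT
  have hp := ofLen (pNC M T hTc cT hTb) hX
  have hw : CodeFP inP (rawE natE) (fun t => digitsLE (pN M T t.1.length) (mN M T t.1.length) (t.2 / b0 M T t.1.length)) :=
    digitsCode.comp ((hp.pair (ofLen (mNU M T hTc cT hTb) hX)).pair (natDiv.comp ((CodeFP.snd _ _).pair (ofLen (b0C M T hTc cT hTb) hX))))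
  have hv : CodeFP inP natE (fun t => YhN M (pN M T t.1.length) (hN M t.1.length) (ktN M T t.1.length) (kJN M T t.1.length) t.1 []
      (T t.1.length + 1) (S1N M T t.1.length + 1) (digitsLE (pN M T t.1.length) (mN M T t.1.length) (t.2 / b0 M T t.1.length))) :=
    ((YhNC M).comp (((hp.pair (ofLen (hNU M T cT hTb) hX)).pair ((ofLen (ktNU M T hTc cT hTb) hX).pair (ofLen (kJNU M T hTc cT hTb) hX))).pair
      (hX.pair ((TBC M T hTc cT hTb).pair ((SBC M T hTc cT hTb).pair hw))))).congr fun _ => rfl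
  exact (bitOfC M T hTc cT hTb hv (natMod.comp ((CodeFP.snd _ _).pair (ofLen (b0C M T hTc cT hTb) hX))) fun t =>
    Nat.mod_lt _ (b0_pos M T t.1.length)).congr fun _ => by unfold yBit; rfl

/-- Building the prover's context from its tuple. [folklore] -/
theorem mkPCtxC : CodeFP ptupE pcE (fun t => (⟨t.1, t.2.1, t.2.2.1, t.2.2.2.1, t.2.2.2.2.1, t.2.2.2.2.2.1, t.2.2.2.2.2.2.1, t.2.2.2.2.2.2.2.1,
    t.2.2.2.2.2.2.2.2⟩ : PCtx)) :=
  CodeFP.transparent fun _ => rfl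

include hTc hTb in
/-- `D` in unary. [folklore] -/
theorem DNU : CodeFP unE unE (DN M T) :=
  unaryOf M cT (DNC M T hTc) fun n => by have := (params_le_WW M T cT hTb n).2.2.2.1; omega

include hTc hTb in
/-- **The prover's context** on the pad. [folklore] -/
theorem pctxC : CodeFP inP pcE (fun t => pctx M T cT t.1) := by
  have hX := padX M cT
  have hp := ofLen (pNC M T hTc cT hTb) hX
  have hn : CodeFP inP natE (fun t => t.1.length) := (natOfUn.comp strLength).comp hX.fst'
  have hprm : CodeFP inP prmE (fun t => (⟨pN M T t.1.length, hN M t.1.length, ktN M T t.1.length, kJN M T t.1.length, t.1.length, 0, T t.1.length⟩ : Prm)) :=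
    (mkPrmC.comp (hp.pair ((ofLen (hNU M T cT hTb) hX).pair ((ofLen (ktNU M T hTc cT hTb) hX).pair ((ofLen (kJNU M T hTc cT hTb) hX).pair
      (hn.pair ((CodeFP.const _ 0).pair (ofLen hTc hX)))))))).congr fun _ => rfl
  have hds : CodeFP inP (rawE fdE) (fun t => descs M t.1.length 0 (T t.1.length) t.1) :=
    ((descsC M).comp ((hn.pair ((CodeFP.const _ 0).pair (ofLen hTc hX))).pair hX.fst')).congr fun _ => rfl
  exact (mkPCtxC.comp (hprm.pair ((ofLen (KNU M T hTc cT hTb) hX).pair ((ofLen (DNU M T hTc cT hTb) hX).pair ((TBC M T hTc cT hTb).pair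
    ((SBC M T hTc cT hTb).pair ((padBudgetC M cT).pair (hX.fst'.pair ((CodeFP.const _ []).pair hds))))))))).congr fun t => by
      unfold pctx actx; rfl

include hTc hTb in
/-- **The message-region bit** on the pad. [cite: BFLS1991, §5] -/
theorem sBitC : CodeFP inP bitE (fun t => sBit M T cT t.1 t.2) := by
  have hX := padX M cT
  have hp := ofLen (pNC M T hTc cT hTb) hX
  have hb0 := ofLen (b0C M T hTc cT hTb) hX
  have hK : CodeFP inP natE (fun t => KN M T t.1.length) := ofLen (KNC M T hTc) hX
  have hD1 : CodeFP inP natE (fun t => DN M T t.1.length + 1) := natAdd.comp ((ofLen (DNC M T hTc) hX).pair (CodeFP.const _ 1))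
  have hpK : CodeFP inP natE (fun t => pN M T t.1.length ^ KN M T t.1.length) := (natPow.comp (hp.pair (ofLen (KNU M T hTc cT hTb) hX))).congr fun _ => by dsimp only
  have hbase : CodeFP inP natE (fun t => baseS M T t.1.length) :=
    (natMul.comp ((natPow.comp (hp.pair (ofLen (mNU M T hTc cT hTb) hX))).pair hb0)).congr fun _ => by unfold baseS; dsimp only
  have hk' : CodeFP inP natE (fun t => t.2 - baseS M T t.1.length) := natSub.comp ((CodeFP.snd _ _).pair hbase)
  have hq : CodeFP inP natE (fun t => (t.2 - baseS M T t.1.length) / b0 M T t.1.length) := natDiv.comp (hk'.pair hb0)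
  have hs : CodeFP inP natE (fun t => (t.2 - baseS M T t.1.length) / b0 M T t.1.length / (DN M T t.1.length + 1)) := natDiv.comp (hq.pair hD1)
  have hs1 : CodeFP inP natE (fun t => (t.2 - baseS M T t.1.length) / b0 M T t.1.length / (DN M T t.1.length + 1) / pN M T t.1.length ^ KN M T t.1.length) :=
    natDiv.comp (hs.pair hpK)
  have hs2 : CodeFP inP natE (fun t => (t.2 - baseS M T t.1.length) / b0 M T t.1.length / (DN M T t.1.length + 1) / pN M T t.1.length ^ KN M T t.1.length /
      (KN M T t.1.length + 1)) := natDiv.comp (hs1.pair (natAdd.comp (hK.pair (CodeFP.const _ 1))))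
  have hKu := ofLen (KNU M T hTc cT hTb) hX
  have hrho : CodeFP inP (rawE natE) (fun t => digitsLE (pN M T t.1.length) (KN M T t.1.length) ((t.2 - baseS M T t.1.length) / b0 M T t.1.length /
      (DN M T t.1.length + 1) / pN M T t.1.length ^ KN M T t.1.length / (KN M T t.1.length + 1) / pN M T t.1.length)) :=
    digitsCode.comp ((hp.pair hKu).pair (natDiv.comp (hs2.pair hp)))
  have hseed : CodeFP inP natE (fun t => (t.2 - baseS M T t.1.length) / b0 M T t.1.length / (DN M T t.1.length + 1) / pN M T t.1.length ^ KN M T t.1.length /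
      (KN M T t.1.length + 1) % pN M T t.1.length) := natMod.comp (hs2.pair hp)
  have hpref : CodeFP inP (rawE natE) (fun t => (digitsLE (pN M T t.1.length) (KN M T t.1.length) ((t.2 - baseS M T t.1.length) / b0 M T t.1.length /
      (DN M T t.1.length + 1) % pN M T t.1.length ^ KN M T t.1.length)).take ((t.2 - baseS M T t.1.length) / b0 M T t.1.length / (DN M T t.1.length + 1) /
      pN M T t.1.length ^ KN M T t.1.length % (KN M T t.1.length + 1))) :=
    (rawTakeNat natE).comp ((natMod.comp (hs1.pair (natAdd.comp (hK.pair (CodeFP.const _ 1))))).pair (digitsCode.comp ((hp.pair hKu).pair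
      (natMod.comp (hs.pair hpK)))))
  have hcs := (msgCoeffsC M d).comp ((pctxC M T hTc cT hTb).pair (hrho.pair (hseed.pair hpref)))
  have hcoef := (rawGetD natE natE_zero).comp (hcs.pair (natMod.comp (hq.pair hD1)))
  refine (bitOfC M T hTc cT hTb hcoef (natMod.comp (hk'.pair hb0)) fun t => Nat.mod_lt _ (b0_pos M T t.1.length)).congr fun t => ?_
  unfold sBit
  dsimp only [Function.comp_apply]
  rw [show (pctx M T cT t.1).nrm = pctx M T cT t.1 from by
    unfold PCtx.nrm pctx actx
    simp only [p1, max_eq_left (pN_prime M T t.1.length).one_lt.le]]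

include hTc hTb in
/-- **The recomputed table on the pad.** [cite: BuhrmanFortnowPavan2004, Thm. 3.3] -/
theorem tableBitC : CodeFP inP bitE (fun t => tableBit M T cT t.1 t.2) := by
  have hX := padX M cT
  have hbase : CodeFP inP natE (fun t => baseS M T t.1.length) :=
    (natMul.comp ((natPow.comp ((ofLen (pNC M T hTc cT hTb) hX).pair (ofLen (mNU M T hTc cT hTb) hX))).pair (ofLen (b0C M T hTc cT hTb) hX))).congr
      fun _ => by unfold baseS; dsimp only
  have hlt : CodeFP inP bitE (fun t => decide (t.2 < baseS M T t.1.length)) := natLt.comp ((CodeFP.snd _ _).pair hbase)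
  exact (hlt.ite (yBitC M T hTc cT hTb) (sBitC M T hTc cT hTb)).congr fun t => by unfold tableBit; by_cases h : t.2 < baseS M T t.1.length <;> simp [h]

include hTc hTb in
/-- **The honest proof table is an `FE` object**: a string map in `FE` tabulating `tableBit` below
the budget, hence agreeing with `honestTable` on all read positions and accepted exactly as often.
[cite: BuhrmanFortnowPavan2004, Thm. 3.3] -/
theorem exists_table_FE : ∃ P ∈ FE, ∀ x : List Bool,
    (verifier' M T).acceptProb x (fun i => (P x).getD i false) = (verifier' M T).acceptProb x (honestTable M T x) := by
  obtain ⟨P, hP, hPx⟩ := exists_table_mem_FE (a := aN M cT) (T := fun y => budgetN M cT y.length) (g := tableBit M T cT)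
    ((padBudgetC M cT).comp ((CodeFP.id _).pair (CodeFP.const _ 0))) (tableBitC M T hTc cT hTb)
  exact ⟨P, hP, fun x => acceptProb_table M T cT x hTb hPx⟩

end FP

end ScaledPCP

end Literature.Computability.Complexity

end
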